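import Summits.NavierStokesRegularity.NavierStokesRegularity.Theorems.ScalingDefectPeepholeDoorSerrinSpinDuality
import HarnessLib

/-!
# ScalingDefectPeepholeDoorSerrinSpinL2 — door S30 «ScalingDefectPeepholeDoor», effective plate E0 (step E1d):
# the PRESSURE-FREE interior `L²` bound for the vorticity of a bounded distributional Navier–Stokes solution

Fourth file of the pressure-free chain: Riesz–Fréchet (`HeatDivForm.exists_memLp_two_repr_of_test_bound`)
turns the duality bound `…SerrinSpinDuality.abs_integral_test_mul_spinEntry_le` into
**`A_{bc} = ∂_c u_b - ∂_b u_c ∈ L²(]-L', 0[ × B(0, ρ'))` with `‖A_{bc}‖_{L²} ≤ C (|M| + M²)`** for every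
bounded distributional Navier–Stokes solution on `Q*_R(-R², 0) = ]-2R², 0[ × B(0, R)` with a weak spatial
gradient — no pressure hypothesis, no integrability hypothesis on the gradient (Serrin 1962;
Chen–Strain–Tsai–Yau 2009, Lemma A.2; Pineau–Vicol 2026, Lemma 9.1).  This is the `L²` START that makes the
tree's Serrin bootstrap (`NSBootstrap.spin_bound_backward_quant`, `NSBootstrap.level_step`) run without
`‖p‖_{3/2}`, towards the effective order `QuietVortexCoreRigidityU` of LEG Cω.

Door S30 is a regularity CRITERION inside a HYPOTHETICAL local Type-I blow-up; item 0056 `NoTypeII`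
stays OPEN; nothing here bears on NS regularity itself.
-/

noncomputable section

set_option linter.dupNamespace false

namespace Summit.NavierStokesRegularity.NavierStokesRegularity.Theorems.ScalingDefectPeepholeDoor

namespace Serrin

open MeasureTheory Set Function Filter Topology TopologicalSpace Metric InnerProductSpace
open scoped NNReal ENNReal RealInnerProductSpace Laplacian ContDiff
open Literature.Analysis Literature.Analysis.FluidPDE

/-! ### The `L²` bound -/

/-- **The pressure-free interior `L²` bound for the spin entries** (Serrin 1962: "each derivative is
bounded in compact subregions"; Chen–Strain–Tsai–Yau 2009, Lemma A.2; Pineau–Vicol 2026, Lemma 9.1: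
interior estimates for bounded Navier–Stokes solutions without the pressure). On
`Q = Q*_R(-R², 0) = ]-2R², 0[ × B(0, R)`: for every distributional Navier–Stokes solution `(u, p)`
(`ν = 1`, `f = 0`) with `|u| ≤ M` a.e. on `Q` and a weak spatial gradient `G` on `Q` (no integrability
of `G`, nothing on `p`), every spin entry `A_{bc} = G_{bc} - G_{cb} = ∂_c u_b - ∂_b u_c` lies in
`L²(]-L', 0[ × B(0, ρ'))` for `0 < L' < 2R²`, `0 < ρ' < R`, with
`‖A_{bc}‖_{L²} ≤ C (|M| + M²)`, `C = C(R, L', ρ')`. [folklore] -/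
theorem spinEntry_memLp_two {R L' ρ' : ℝ} (hR : 0 < R) (hL' : 0 < L') (hL : L' < 2 * R ^ 2)
    (hρ' : 0 < ρ') (hρ : ρ' < R) :
    ∃ C : ℝ, 0 ≤ C ∧ ∀ (M : ℝ) (u : ℝ → EuclideanSpace ℝ (Fin 3) → EuclideanSpace ℝ (Fin 3))
      (p : ℝ → EuclideanSpace ℝ (Fin 3) → ℝ)
      (G : ℝ → EuclideanSpace ℝ (Fin 3) → EuclideanSpace ℝ (Fin 3) →L[ℝ] EuclideanSpace ℝ (Fin 3)),
      IsDistributionalNSSolutionOn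
        (parabolicCylinderCenteredOpens R ((-R ^ 2 : ℝ), (0 : EuclideanSpace ℝ (Fin 3)))) 1 0 u p →
      (∀ᵐ q ∂(volume.restrict
        (parabolicCylinderCentered R ((-R ^ 2 : ℝ), (0 : EuclideanSpace ℝ (Fin 3))))), ‖u q.1 q.2‖ ≤ M) →
      HasWeakSpatialGradientOn
        (parabolicCylinderCenteredOpens R ((-R ^ 2 : ℝ), (0 : EuclideanSpace ℝ (Fin 3)))) u G →
      ∀ b c : Fin 3,
        MemLp (spinEntry G b c) 2
          (volume.restrict (Ioo (-L') 0 ×ˢ ball (0 : EuclideanSpace ℝ (Fin 3)) ρ')) ∧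
        eLpNorm (spinEntry G b c) 2
          (volume.restrict (Ioo (-L') 0 ×ˢ ball (0 : EuclideanSpace ℝ (Fin 3)) ρ')) ≤
          ENNReal.ofReal (C * (|M| + M ^ 2)) := by
  obtain ⟨C, hC0, hC⟩ := abs_integral_test_mul_spinEntry_le hR hL' hL hρ' hρ
  refine ⟨C, hC0, fun M u p G hsol hbd hG b c => ?_⟩
  set z₀ : ℝ × EuclideanSpace ℝ (Fin 3) := ((-R ^ 2 : ℝ), (0 : EuclideanSpace ℝ (Fin 3))) with hz₀
  set Qs : Set (ℝ × EuclideanSpace ℝ (Fin 3)) := parabolicCylinderCentered R z₀ with hQs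
  set Qo : Opens (ℝ × EuclideanSpace ℝ (Fin 3)) := parabolicCylinderCenteredOpens R z₀ with hQo
  set Qs' : Set (ℝ × EuclideanSpace ℝ (Fin 3)) := Ioo (-L') 0 ×ˢ ball (0 : EuclideanSpace ℝ (Fin 3)) ρ'
    with hQs'
  set Qo' : Opens (ℝ × EuclideanSpace ℝ (Fin 3)) := ⟨Qs', isOpen_Ioo.prod isOpen_ball⟩ with hQo'
  have h2R : -(2 * R ^ 2) < -L' := by linarith
  have hQ'Q : Qs' ⊆ Qs := by
    intro q hq
    show q ∈ parabolicCylinderCentered R z₀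
    simp only [parabolicCylinderCentered, hz₀, mem_prod, mem_Ioo, mem_ball]
    have h3 : dist q.2 0 < ρ' := hq.2
    exact ⟨⟨by linarith [hq.1.1], by linarith [hq.1.2]⟩, by linarith⟩
  have hQoQ : Qo' ≤ Qo := hQ'Q
  have hQ'meas : MeasurableSet Qs' := (isOpen_Ioo.prod isOpen_ball).measurableSet
  have hQ'fin : volume Qs' < ⊤ := by
    rw [hQs', Measure.volume_eq_prod, Measure.prod_prod]
    exact ENNReal.mul_lt_top (by simp [Real.volume_Ioo]) measure_ball_lt_top
  haveI : IsFiniteMeasure ((volume : Measure (ℝ × EuclideanSpace ℝ (Fin 3))).restrict Qs') :=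
    isFiniteMeasure_restrict.2 hQ'fin.ne
  -- the spin entry is locally integrable on `Q`
  have hAloc : LocallyIntegrableOn (spinEntry G b c) Qs volume := by
    have h1 := NSSpinHeat.locallyIntegrableOn_gradE hG.locallyIntegrableOn_grad b c
    have h2 := NSSpinHeat.locallyIntegrableOn_gradE hG.locallyIntegrableOn_grad c b
    have e : spinEntry G b c = fun q => NSSpinHeat.gradE G b c q - NSSpinHeat.gradE G c b q := by
      funext q; simp only [spinEntry, NSSpinHeat.gradE_apply]
    rw [e]; exact h1.sub h2
  set N : ℝ := C * (|M| + M ^ 2) with hN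
  have hN0 : 0 ≤ N := by positivity
  -- curried form of an uncurried test function
  have hcur : ∀ {θ : ℝ × EuclideanSpace ℝ (Fin 3) → ℝ},
      Literature.Analysis.FunctionSpaces.IsTestFunctionOn Qo' θ →
      IsSpaceTimeTestOn Qo' (fun t x => θ (t, x)) := fun hθ => hθ
  -- the functional
  set Λ : (ℝ × EuclideanSpace ℝ (Fin 3) → ℝ) → ℝ := fun θ =>
    ∫ q : ℝ × EuclideanSpace ℝ (Fin 3), θ q * spinEntry G b c q with hΛ
  have hint : ∀ {θ : ℝ × EuclideanSpace ℝ (Fin 3) → ℝ},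
      Literature.Analysis.FunctionSpaces.IsTestFunctionOn Qo' θ →
      Integrable (fun q : ℝ × EuclideanSpace ℝ (Fin 3) => θ q * spinEntry G b c q) := by
    intro θ hθ
    have h := NSSpinHeat.integrable_test_mul hAloc ((hcur hθ).mono hQoQ)
    exact h
  have hadd : ∀ f g' : ℝ × EuclideanSpace ℝ (Fin 3) → ℝ,
      Literature.Analysis.FunctionSpaces.IsTestFunctionOn Qo' f →
      Literature.Analysis.FunctionSpaces.IsTestFunctionOn Qo' g' → Λ (f + g') = Λ f + Λ g' := by
    intro f g' hf hg'
    simp only [hΛ]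
    rw [← integral_add (hint hf) (hint hg')]
    refine integral_congr_ae (Eventually.of_forall fun q => ?_)
    simp only [Pi.add_apply]; ring
  have hsmul : ∀ (a : ℝ) (f : ℝ × EuclideanSpace ℝ (Fin 3) → ℝ),
      Literature.Analysis.FunctionSpaces.IsTestFunctionOn Qo' f → Λ (a • f) = a * Λ f := by
    intro a f hf
    simp only [hΛ]
    rw [← integral_const_mul]
    refine integral_congr_ae (Eventually.of_forall fun q => ?_)
    simp only [Pi.smul_apply, smul_eq_mul]; ring
  have hbdΛ : ∀ f : ℝ × EuclideanSpace ℝ (Fin 3) → ℝ,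
      Literature.Analysis.FunctionSpaces.IsTestFunctionOn Qo' f →
      |Λ f| ≤ N * (eLpNorm f 2 (volume.restrict Qs')).toReal := by
    intro f hf
    simp only [hΛ]
    have h := hC M u p G hsol hbd hG b c (fun t x => f (t, x)) (hcur hf)
    refine h.trans (le_of_eq ?_)
    rw [hN]
    congr 1
    have hf2 : MemLp f 2 (volume.restrict Qs') :=
      (hf.contDiff.continuous.memLp_of_hasCompactSupport hf.hasCompactSupport).restrict _
    rw [HeatDivForm.toReal_eLpNorm_two_eq_sqrt hf2]
    congr 1
    refine (setIntegral_eq_integral_of_forall_compl_eq_zero fun q hq => ?_).symm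
    have : f q = 0 := image_eq_zero_of_notMem_tsupport fun h' => hq (hf.tsupport_subset h')
    rw [show f (q.1, q.2) = f q from rfl, this]; simp
  obtain ⟨Gf, hGm, hGn, hGrep⟩ := HeatDivForm.exists_memLp_two_repr_of_test_bound
    (volume : Measure (ℝ × EuclideanSpace ℝ (Fin 3))) Qo' Λ hadd hsmul hN0 hbdΛ
  -- `A_{bc} = Gf` a.e. on `Q'`
  have hGloc : LocallyIntegrableOn (Qs'.indicator Gf) Qs' volume := by
    have hi : Integrable (Qs'.indicator Gf) volume :=
      IntegrableOn.integrable_indicator (hGm.integrable one_le_two) hQ'meas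
    exact hi.locallyIntegrable.locallyIntegrableOn Qs'
  have hdiff : LocallyIntegrableOn (fun q => Qs'.indicator Gf q - spinEntry G b c q) Qs' volume :=
    hGloc.sub (hAloc.mono_set hQ'Q)
  have hzero := (isOpen_Ioo.prod isOpen_ball : IsOpen Qs').ae_eq_zero_of_integral_contDiff_smul_eq_zero
    (μ := volume) hdiff ?_
  · have hae : spinEntry G b c =ᵐ[volume.restrict Qs'] Gf := by
      rw [Filter.EventuallyEq, ae_restrict_iff' hQ'meas]
      filter_upwards [hzero] with q hq hqQ
      have h := hq hqQ
      rw [indicator_of_mem hqQ, sub_eq_zero] at h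
      exact h.symm
    refine ⟨hGm.ae_eq hae.symm, ?_⟩
    rw [eLpNorm_congr_ae hae]
    exact hGn
  · intro g hg hgc hgQ
    have hθ : Literature.Analysis.FunctionSpaces.IsTestFunctionOn Qo' g := ⟨hg, hgc, hgQ⟩
    have h1 := hGrep g hθ
    simp only [hΛ] at h1
    have i1 : Integrable (fun q => g q * Qs'.indicator Gf q) volume := by
      have : Integrable (fun q => Qs'.indicator Gf q * g q) volume :=
        HeatDivForm.integrable_mul_of_continuous_hasCompactSupport
          (IntegrableOn.integrable_indicator (hGm.integrable one_le_two) hQ'meas) hg.continuous hgc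
      exact this.congr (Eventually.of_forall fun q => mul_comm _ _)
    have i2 : Integrable (fun q => g q * spinEntry G b c q) volume := hint hθ
    have e1 : ∫ q, g q * Qs'.indicator Gf q = ∫ q in Qs', Gf q * g q := by
      rw [← integral_indicator hQ'meas]
      refine integral_congr_ae (Eventually.of_forall fun q => ?_)
      by_cases hq : q ∈ Qs'
      · simp only [indicator_of_mem hq]; ring
      · simp only [indicator_of_notMem hq, mul_zero]
    calc ∫ q, g q • (Qs'.indicator Gf q - spinEntry G b c q)
        = ∫ q, (g q * Qs'.indicator Gf q - g q * spinEntry G b c q) :=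
          integral_congr_ae (Eventually.of_forall fun q => by simp only [smul_eq_mul, mul_sub])
      _ = (∫ q, g q * Qs'.indicator Gf q) - ∫ q, g q * spinEntry G b c q := integral_sub i1 i2
      _ = 0 := by
          have h1' : ∫ q, g q * spinEntry G b c q = ∫ q in Qs', Gf q * g q := h1
          rw [e1, ← h1', sub_self]


end Serrin

end Summit.NavierStokesRegularity.NavierStokesRegularity.Theorems.ScalingDefectPeepholeDoor

end
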